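import Literature.NumberTheory.Rogawski1990.ArchLimitFormula                       -- ★ p840202 (B5): the LETTER `ArchLimitFormulaNoncompactWall` (a `def … : Prop`)
import Literature.NumberTheory.Automorphic.ArchLocalWallAveraging                   -- ★ p840706 (d3a): wall averaging (regular side + singular side); brings (d2′) p840556, (d1) p840426
import Literature.NumberTheory.Automorphic.ArchLocalWallAveragedTestFunction         -- ★ (d3a-II): `f♭ ∈ C¹_c(Matrix (Fin 2) (Fin 2) ℂ)`
import Literature.NumberTheory.Automorphic.ArchRankOneLimitFormulaGroup              -- ★ p840661 (R1G) B-p17 ∕ (HB) p07: `exists_tendsto_deriv_two_sin_smul_orbitalIntegral`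
import Literature.NumberTheory.Automorphic.ArchLocalRegularOrbitClosed               -- ★ `locallyCompactSpace_archLocal`, `secondCountableTopology_archLocal`
import Literature.NumberTheory.Automorphic.ArchTorusOneAngleCurve                    -- ★ (V4): `continuous_torusCurve`
import Literature.MeasureTheory.Group.BruhatLocalCutoff                              -- ★ p840607 (γ)(1): the local Bruhat cut-off
import Literature.Analysis.Calculus.ContDiffCompactSupportCutoff                     -- ★ p840156: ambient compact support WLOG
import Mathlib.NumberTheory.NumberField.CMField
import HarnessLib

/-!
# PROOF OF THE LETTER (J-nc) `ArchLimitFormulaNoncompactWall` — Harish-Chandra's limit formula at a NONCOMPACT wall of the circle torus of `G_w = U(σ_w diag α)(ℂ)`, descended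
# form (Rogawski 1990 §8.2 p. 119, Varadarajan 1989 §6.4 Thm 22), for CM fields `L` and hermitian-diagonal `α`

Topic `NumberTheory/Rogawski1990`; namespace `Literature.NumberTheory.Rogawski1990`.  ONE THEOREM (no `def`, no instance, no notation, no axiom, no named fact, no `sorry`):
**`archLimitFormulaNoncompactWall_holds [NumberField L] [IsCMField L] : ArchLimitFormulaNoncompactWall L α w`** — the letter ★ p840202 BY NAME.  Cell `pub/hodgecm-mathlib`,
ENGINE T1 (crux H413 = `stmt-HodgeConjecture-24833`); floor-2 letter (J-nc) of the S-d chain (books rows #111 (S-d) ∕ #88 (ST-∞)), PLAN v8 «(J-nc) in-house road», LEAD DESK WORDS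
T8-28 (1) ∕ T8-31 (1) ∕ T8-36 ∕ T8-44 (F0P3a-plan (g9), 2026-09-01); author F0P3a-p06 (g10) (d-chain), rank-one side B-p17 (g23∕g24) ((M4) FILE M, (R1G)) and F0P3a-p07 (g7) (HAT-BOX
(H1)(H2a)(H2b)).  The extra instance binders `[NumberField L] [IsCMField L]` (the route's case) are inherited from ★ (d1) `ArchLocalWallDescentCompact` (phrased over the CM conjugation);
the hermitian-diagonal condition `c(α_i) = α_i` is DERIVED inside from the letter's `(σ_w α_i).im = 0` (Mathlib `NumberField.IsCMField.complexEmbedding_complexConj`).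

THE PROOF (no uniform derivative bounds, no Banach-valued test functions).  Fix the letter's data `ν`, `z₁` (naming `H_w = Z(t_w z₁) ≅ G₂ × G₁`, ★ (V9)), `ν_H`; put Haar measures `μ₂`,
`μ₁` on `G₂ = U(σ_w diag(α₀,α₂))(ℂ)`, `G₁ = U(σ_w α₁)(ℂ)`.  ★ (d3a) gives ONE `c₀ > 0` and ★ (R1G) ONE `C ≠ 0`; the letter's constant is `c = c₀·C`.  Given `Θ` (WLOG of AMBIENT compact
support, ★ p840156) and a wall point `z₀`: the (J-nc) curve `z_ψ` stays, for `|ψ| ≤ δ`, inside a compact `{1}`-separated set `K` of torus points, so ★ (d1) p840426 provides ONE compact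
`S ⊆ G_w ⧸ H_w` with `g t_w z g⁻¹ ∈ supp Θ ⇒ gH_w ∈ S` (`z ∈ K`), and ★ p840607 a cut-off `β ∈ C_c(G_w)` with `∫_{H_w} β(g h) dν_H(h) = 1` on `S`.  By ★ (d3a), for `0 < |ψ| < δ`,
`∫_{G_w} Θ(g t_w z_ψ g⁻¹) dν(g) = c₀ · ∫_{G₂} f♭(↑↑(h₂ · diag(z₀(0)e^{iψ}, z₀(0)e^{−iψ}) · h₂⁻¹)) dμ₂(h₂)` with the SINGLE averaged test function
`f♭(X) = ∫_{G_w} β(g) Θ(↑↑g · endoForm X (diag z₀(1)) · ↑↑g⁻¹) dν(g) ∈ C¹_c(Matrix (Fin 2) (Fin 2) ℂ)` (★ (d3a-II)), and `f♭(z₀(0)·1) = ∫_{G_w ⧸ H_w} descConj (t_w z₀) Θ d(ν∕ν_H)` (★ (d3a),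
singular side).  Hence `2 sin ψ · F_Θ(z_ψ) = c₀ · [2 sin ψ · Orb_{G₂}(f♭)(ψ)]` on `0 < |ψ| < δ`, the `ψ`-derivatives agree there, and ★ (R1G) `exists_tendsto_deriv_two_sin_smul_orbitalIntegral`
(Harish-Chandra's limit formula on `U(e₀,e₂)`, through p07's orbit chart (HB) and B-p17's FILE M) yields `lim_{ψ→0, ψ≠0} ∂_ψ[2 sin ψ · F_Θ(z_ψ)] = c₀ · C · f♭(z₀(0)·1) = c · ∫ descConj (t_w z₀) Θ`.
HONEST LABEL: this closes the letter (J-nc) for CM `L`; HC_CM is proved only modulo the remaining printed citations until rung 0 closes.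

## References
* [Rogawski1990] J. D. Rogawski, *Automorphic Representations of Unitary Groups in Three Variables*, Ann. of Math. Stud. 123 (1990), §8.2 p. 119 (Harish-Chandra's limit formula at
  `γ₀`), p. 123 (descent to `H`).
* [Varadarajan1989] V. S. Varadarajan, *An Introduction to Harmonic Analysis on Semisimple Lie Groups* (1989), §6.4 Thm 22, Lemma 21.
* [Folland1995] G. B. Folland, *A Course in Abstract Harmonic Analysis* (1995), §2.6 (Weil's formula, Bruhat cut-offs).
-/

set_option autoImplicit false

noncomputable section

open MeasureTheory Measure Filter Topology NumberField NumberField.InfinitePlace Set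
open Literature.MeasureTheory.Group Literature.NumberTheory.Automorphic Literature.NumberTheory.Automorphic.UnitaryGroup Literature.Analysis.Calculus
open scoped Matrix MatrixGroups Matrix.Norms.Operator Pointwise

namespace Literature.NumberTheory.Rogawski1990

variable (L : Type) [Field L] [NumberField L] [IsCMField L] (α : Fin 3 → L) (w : {w : InfinitePlace L // IsComplex w})

/-- **THE LETTER (J-nc) HOLDS** for a CM field `L` (hermitian-diagonal `α` is forced by the letter's own hypothesis `(σ_w α_i).im = 0`): Harish-Chandra's limit formula at the noncompact
wall, descended form — `lim_{ψ → 0, ψ ≠ 0} ∂_ψ [2 sin ψ · ∫_{G_w} Θ(g diag(z_ψ) g⁻¹) dν] = c · ∫_{G_w ⧸ H_w} descConj (diag z₀) Θ d(ν∕ν_H)` with ONE `c ≠ 0` for all `Θ`, `z₀`.  Proof: module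
docstring (★ (d1)(d2′)(d3a)(d3a-II), ★ `BruhatLocalCutoff`, ★ (R1G) ∕ (HB) ∕ FILE M). [cite: Rogawski1990, §8.2 p. 119] [cite: Varadarajan1989, §6.4 Thm 22, Lemma 21] -/
theorem archLimitFormulaNoncompactWall_holds : ArchLimitFormulaNoncompactWall L α w := by
  intro _ _ _ _ hα hreal ν _ _ z₁ h02 h01 hsgn νH _ _ _ _
  classical
  -- topology and Haar measures on the block groups `G₂`, `G₁`
  haveI : LocallyCompactSpace (unitaryGroupOfForm (starRingEnd ℂ) ((Matrix.diagonal ![α 0, α 2]).map w.1.embedding)) := locallyCompactSpace_archLocal L 2 (Matrix.diagonal ![α 0, α 2]) w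
  haveI : SecondCountableTopology (unitaryGroupOfForm (starRingEnd ℂ) ((Matrix.diagonal ![α 0, α 2]).map w.1.embedding)) := secondCountableTopology_archLocal L 2 (Matrix.diagonal ![α 0, α 2]) w
  haveI : LocallyCompactSpace (unitaryGroupOfForm (starRingEnd ℂ) ((Matrix.diagonal ![α 1]).map w.1.embedding)) := locallyCompactSpace_archLocal L 1 (Matrix.diagonal ![α 1]) w
  haveI : SecondCountableTopology (unitaryGroupOfForm (starRingEnd ℂ) ((Matrix.diagonal ![α 1]).map w.1.embedding)) := secondCountableTopology_archLocal L 1 (Matrix.diagonal ![α 1]) w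
  letI : MeasurableSpace (unitaryGroupOfForm (starRingEnd ℂ) ((Matrix.diagonal ![α 0, α 2]).map w.1.embedding)) := borel _
  haveI : BorelSpace (unitaryGroupOfForm (starRingEnd ℂ) ((Matrix.diagonal ![α 0, α 2]).map w.1.embedding)) := ⟨rfl⟩
  letI : MeasurableSpace (unitaryGroupOfForm (starRingEnd ℂ) ((Matrix.diagonal ![α 1]).map w.1.embedding)) := borel _
  haveI : BorelSpace (unitaryGroupOfForm (starRingEnd ℂ) ((Matrix.diagonal ![α 1]).map w.1.embedding)) := ⟨rfl⟩
  -- hermitian-diagonal from the letter's reality hypothesis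
  have hherm : ∀ i, (IsCMField.complexConj L (α i) : L) = α i := fun i => by
    apply w.1.embedding.injective
    rw [NumberField.IsCMField.complexEmbedding_complexConj, Complex.conj_eq_iff_im, hreal i]
  have hZ : IsClosed ((Subgroup.centralizer ({(⟨circleDiagonal 3 z₁, circleDiagonal_mem_archLocal_diagonal L 3 α w z₁⟩ : archLocal L 3 (Matrix.diagonal α) w)} : Set (archLocal L 3 (Matrix.diagonal α) w))) : Set (archLocal L 3 (Matrix.diagonal α) w)) := isClosed_coe_centralizer_singleton _
  -- `H_w ≃ₜ* G₂ × G₁` (★ (V9))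
  obtain ⟨e, he⟩ := exists_centralizer_continuousMulEquiv_of_splitSingular L α w h02 h01
  -- the regular-side constant `c₀` (★ (d3a)) and the rank-one constant `C` (★ (R1G))
  obtain ⟨c₀, hc₀, hB⟩ := exists_integral_comp_conj_circleDiagonal_eq_mul_integral_averaged L α w hα hreal e he νH
    (haar : Measure (unitaryGroupOfForm (starRingEnd ℂ) ((Matrix.diagonal ![α 0, α 2]).map w.1.embedding))) (haar : Measure (unitaryGroupOfForm (starRingEnd ℂ) ((Matrix.diagonal ![α 1]).map w.1.embedding))) ν
  have hreal2 : ∀ i, (w.1.embedding (![α 0, α 2] i)).im = 0 := fun i => by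
    fin_cases i
    · exact hreal 0
    · exact hreal 2
  have hsgn2 : (w.1.embedding (![α 0, α 2] 0)).re * (w.1.embedding (![α 0, α 2] 1)).re < 0 := by simpa using hsgn
  obtain ⟨C, hC, hR⟩ := exists_tendsto_deriv_two_sin_smul_orbitalIntegral (E := ℂ) w.1.embedding ![α 0, α 2] hreal2 hsgn2 (haar : Measure (unitaryGroupOfForm (starRingEnd ℂ) ((Matrix.diagonal ![α 0, α 2]).map w.1.embedding)))
  refine ⟨((c₀ * C : ℝ) : ℂ), Complex.ofReal_ne_zero.mpr (mul_ne_zero hc₀.ne' hC), fun Θ hΘ hΘs z₀ h02' h01' => ?_⟩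
  -- WLOG `Θ` has AMBIENT compact support (★ p840156): both sides only read `Θ ∘ ↑↑`
  have hcoe : Continuous fun k : archLocal L 3 (Matrix.diagonal α) w => ((k : GL (Fin 3) ℂ) : Matrix (Fin 3) (Fin 3) ℂ) := Units.continuous_val.comp continuous_subtype_val
  obtain ⟨Θ', hΘ', hΘ's, -, hagree⟩ := exists_contDiff_hasCompactSupport_comp_eq (ι := fun k : archLocal L 3 (Matrix.diagonal α) w => ((k : GL (Fin 3) ℂ) : Matrix (Fin 3) (Fin 3) ℂ)) hcoe hΘ hΘs
  have hagree' : ∀ k : archLocal L 3 (Matrix.diagonal α) w, Θ ((k : GL (Fin 3) ℂ) : Matrix (Fin 3) (Fin 3) ℂ) = Θ' ((k : GL (Fin 3) ℂ) : Matrix (Fin 3) (Fin 3) ℂ) := fun k => (hagree k).symm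
  simp_rw [hagree']
  have hΘ'c : Continuous Θ' := hΘ'.continuous
  have hΘ'1 : ContDiff ℝ 1 Θ' := hΘ'.of_le (by exact_mod_cast le_top)
  have hΘ'k : HasCompactSupport fun k : archLocal L 3 (Matrix.diagonal α) w => Θ' ((k : GL (Fin 3) ℂ) : Matrix (Fin 3) (Fin 3) ℂ) := by
    have h : (fun k : archLocal L 3 (Matrix.diagonal α) w => Θ' ((k : GL (Fin 3) ℂ) : Matrix (Fin 3) (Fin 3) ℂ)) = fun k : archLocal L 3 (Matrix.diagonal α) w => Θ ((k : GL (Fin 3) ℂ) : Matrix (Fin 3) (Fin 3) ℂ) := funext fun k => (hagree' k).symm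
    rw [h]; exact hΘs
  -- the curve near the wall point: a `δ₁` with `z₀ 0 · e^{iψ} ≠ z₀ 1` for `|ψ| < δ₁`
  have hne0 : (fun ψ : ℝ => z₀ 0 * Circle.exp ψ) 0 ≠ z₀ 1 := by simpa [Circle.exp_zero] using h01'
  obtain ⟨δ₁, hδ₁, hδ₁ne⟩ : ∃ δ₁ > 0, ∀ ψ : ℝ, |ψ| < δ₁ → z₀ 0 * Circle.exp ψ ≠ z₀ 1 := by
    have hopen : IsOpen {ψ : ℝ | z₀ 0 * Circle.exp ψ ≠ z₀ 1} :=
      isOpen_ne_fun (continuous_const.mul Circle.exp.continuous) continuous_const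
    obtain ⟨δ₁, hδ₁, hball⟩ := Metric.isOpen_iff.mp hopen 0 hne0
    exact ⟨δ₁, hδ₁, fun ψ hψ => hball (by simpa [Real.dist_eq] using hψ)⟩
  -- the compact set of torus parameters `K = z([−δ, δ])`, `δ = min (δ₁∕2) (1∕2)`
  obtain ⟨δ, hδdef⟩ : ∃ δ : ℝ, δ = min (δ₁ / 2) (1 / 2) := ⟨_, rfl⟩
  have hδ : 0 < δ := by rw [hδdef]; exact lt_min (by linarith) (by norm_num)
  have hδ₁' : ∀ ψ : ℝ, |ψ| ≤ δ → |ψ| < δ₁ := fun ψ hψ => by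
    have : δ ≤ δ₁ / 2 := by rw [hδdef]; exact min_le_left _ _
    linarith
  have hδ1 : ∀ ψ : ℝ, |ψ| < δ → |ψ| < 1 := fun ψ hψ => by
    have : δ ≤ 1 / 2 := by rw [hδdef]; exact min_le_right _ _
    linarith
  have hz0 : ∀ ψ : ℝ, (fun i => z₀ i * Circle.exp (![(1 : ℝ), 0, -1] i * ψ)) 0 = z₀ 0 * Circle.exp ψ := fun ψ => by simp
  have hz1 : ∀ ψ : ℝ, (fun i => z₀ i * Circle.exp (![(1 : ℝ), 0, -1] i * ψ)) 1 = z₀ 1 := fun ψ => by simp [Circle.exp_zero]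
  have hz2 : ∀ ψ : ℝ, (fun i => z₀ i * Circle.exp (![(1 : ℝ), 0, -1] i * ψ)) 2 = z₀ 0 * Circle.exp (-ψ) := fun ψ => by simp [h02']
  have hsep : ∀ ψ : ℝ, |ψ| < δ₁ → (fun i => z₀ i * Circle.exp (![(1 : ℝ), 0, -1] i * ψ)) 1 ≠ (fun i => z₀ i * Circle.exp (![(1 : ℝ), 0, -1] i * ψ)) 0 ∧ (fun i => z₀ i * Circle.exp (![(1 : ℝ), 0, -1] i * ψ)) 1 ≠ (fun i => z₀ i * Circle.exp (![(1 : ℝ), 0, -1] i * ψ)) 2 := fun ψ hψ => by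
    refine ⟨?_, ?_⟩
    · rw [hz1, hz0]; exact (hδ₁ne ψ hψ).symm
    · rw [hz1, hz2]; exact (hδ₁ne (-ψ) (by simpa using hψ)).symm
  have hreg : ∀ ψ : ℝ, ψ ≠ 0 → |ψ| < δ → ∀ i j : Fin 3, i ≠ j → (fun i => z₀ i * Circle.exp (![(1 : ℝ), 0, -1] i * ψ)) i ≠ (fun i => z₀ i * Circle.exp (![(1 : ℝ), 0, -1] i * ψ)) j := by
    intro ψ hψ0 hψ
    have h01ψ := (hsep ψ ((hδ₁' ψ hψ.le))).1
    have h12ψ := (hsep ψ ((hδ₁' ψ hψ.le))).2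
    have h02ψ : (fun i => z₀ i * Circle.exp (![(1 : ℝ), 0, -1] i * ψ)) 0 ≠ (fun i => z₀ i * Circle.exp (![(1 : ℝ), 0, -1] i * ψ)) 2 := by
      rw [hz0, hz2]
      intro h
      have h' : Circle.exp ψ = Circle.exp (-ψ) := mul_left_cancel h
      obtain ⟨m, hm⟩ := Circle.exp_eq_exp.mp h'
      have hψ1 : |ψ| < 1 := hδ1 ψ hψ
      have hm0 : (m : ℝ) = 0 ∨ (1 : ℝ) ≤ |(m : ℝ)| := by
        rcases eq_or_ne m 0 with h0 | h0
        · left; simp [h0]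
        · right; exact_mod_cast Int.one_le_abs h0
      rcases hm0 with hm0 | hm1
      · rw [hm0, zero_mul, add_zero] at hm; exact hψ0 (by linarith)
      · have : (2 : ℝ) * ψ = m * (2 * Real.pi) := by linarith
        have h2 : |(2 : ℝ) * ψ| = |(m : ℝ)| * (2 * Real.pi) := by
          rw [this, abs_mul, abs_of_pos (by positivity : (0 : ℝ) < 2 * Real.pi)]
        have h3 : |(2 : ℝ) * ψ| < 2 := by rw [abs_mul, abs_two]; linarith
        nlinarith [Real.pi_gt_three, abs_nonneg (m : ℝ)]
    intro i j hij
    fin_cases i <;> fin_cases j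
    all_goals first | exact absurd rfl hij | exact h01ψ.symm | exact h01ψ | exact h12ψ | exact h12ψ.symm | exact h02ψ | exact h02ψ.symm
  -- (d1): ONE compact `S ⊆ G_w ⧸ H_w` carrying the conjugates into `supp Θ` of every `t_w z`, `z ∈ K`
  have hKc : IsCompact ((fun ψ : ℝ => (fun i => z₀ i * Circle.exp (![(1 : ℝ), 0, -1] i * ψ))) '' Metric.closedBall (0 : ℝ) δ) :=
    (isCompact_closedBall (0 : ℝ) δ).image (continuous_torusCurve z₀ ![(1 : ℝ), 0, -1])
  have hKsep : (fun ψ : ℝ => (fun i => z₀ i * Circle.exp (![(1 : ℝ), 0, -1] i * ψ))) '' Metric.closedBall (0 : ℝ) δ ⊆ {z | z 1 ≠ z 0 ∧ z 1 ≠ z 2} := by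
    rintro _ ⟨ψ, hψ, rfl⟩
    have hψ' : |ψ| ≤ δ := by simpa [Real.dist_eq] using hψ
    exact hsep ψ (hδ₁' ψ hψ')
  obtain ⟨S, hS, hSmem⟩ := exists_isCompact_forall_mk_mem_of_conj_mem_wall L α w hα hherm h02 h01 hKc hKsep hΘ'k.isCompact
  -- the local Bruhat cut-off over `S` (★ p840607)
  obtain ⟨β, hβ, hβs, -, -, hβ1⟩ := exists_hasCompactSupport_integral_mul_fiber_eq_one (Subgroup.centralizer ({(⟨circleDiagonal 3 z₁, circleDiagonal_mem_archLocal_diagonal L 3 α w z₁⟩ : archLocal L 3 (Matrix.diagonal α) w)} : Set (archLocal L 3 (Matrix.diagonal α) w))) νH hZ hS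
  have h1 : ∀ ψ : ℝ, |ψ| ≤ δ → ∀ g : archLocal L 3 (Matrix.diagonal α) w, Θ' (((g * ⟨circleDiagonal 3 (fun i => z₀ i * Circle.exp (![(1 : ℝ), 0, -1] i * ψ)), circleDiagonal_mem_archLocal_diagonal L 3 α w _⟩ * g⁻¹ : archLocal L 3 (Matrix.diagonal α) w) : GL (Fin 3) ℂ) : Matrix (Fin 3) (Fin 3) ℂ) ≠ 0 →
      ∫ h : Subgroup.centralizer ({(⟨circleDiagonal 3 z₁, circleDiagonal_mem_archLocal_diagonal L 3 α w z₁⟩ : archLocal L 3 (Matrix.diagonal α) w)} : Set (archLocal L 3 (Matrix.diagonal α) w)), β (g * h) ∂νH = 1 := fun ψ hψ g hg =>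
    hβ1 g (hSmem g _ ⟨ψ, by simpa [Real.dist_eq] using hψ, rfl⟩ (subset_tsupport (fun k : archLocal L 3 (Matrix.diagonal α) w => Θ' ((k : GL (Fin 3) ℂ) : Matrix (Fin 3) (Fin 3) ℂ)) hg))
  -- the averaged test function `f♭` and its regularity (★ (d3a-II))
  have hf : ContDiff ℝ 1 (fun X : Matrix (Fin 2) (Fin 2) ℂ => ∫ g, (β g : ℂ) * Θ' (((g : GL (Fin 3) ℂ) : Matrix (Fin 3) (Fin 3) ℂ) * endoForm X ((circleDiagonal 1 ![z₀ 1] : GL (Fin 1) ℂ) : Matrix (Fin 1) (Fin 1) ℂ) * (((g : GL (Fin 3) ℂ)⁻¹ : GL (Fin 3) ℂ) : Matrix (Fin 3) (Fin 3) ℂ)) ∂ν) :=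
    contDiff_one_averagedTestFunction L α w ν β hβ hβs Θ' hΘ'1 _
  have hfs : HasCompactSupport (fun X : Matrix (Fin 2) (Fin 2) ℂ => ∫ g, (β g : ℂ) * Θ' (((g : GL (Fin 3) ℂ) : Matrix (Fin 3) (Fin 3) ℂ) * endoForm X ((circleDiagonal 1 ![z₀ 1] : GL (Fin 1) ℂ) : Matrix (Fin 1) (Fin 1) ℂ) * (((g : GL (Fin 3) ℂ)⁻¹ : GL (Fin 3) ℂ) : Matrix (Fin 3) (Fin 3) ℂ)) ∂ν) :=
    hasCompactSupport_averagedTestFunction L α w ν β hβs Θ' hΘ's _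
  -- (R1G) for `f♭` at `z = z₀ 0`
  obtain ⟨hlim, hdiff⟩ := hR _ hf hfs (z₀ 0)
  -- the torus elements along the curve
  have hT : ∀ ψ : ℝ, (⟨circleDiagonal 2 ![(fun i => z₀ i * Circle.exp (![(1 : ℝ), 0, -1] i * ψ)) 0, (fun i => z₀ i * Circle.exp (![(1 : ℝ), 0, -1] i * ψ)) 2], (circleDiagonal_blocks_mem L α w (fun i => z₀ i * Circle.exp (![(1 : ℝ), 0, -1] i * ψ))).1⟩ : unitaryGroupOfForm (starRingEnd ℂ) ((Matrix.diagonal ![α 0, α 2]).map w.1.embedding)) =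
      (⟨circleDiagonal 2 ![z₀ 0 * Circle.exp ψ, z₀ 0 * Circle.exp (-ψ)], circleDiagonal_mem_archLocal_diagonal L 2 ![α 0, α 2] w _⟩ : unitaryGroupOfForm (starRingEnd ℂ) ((Matrix.diagonal ![α 0, α 2]).map w.1.embedding)) := fun ψ => by
    apply Subtype.ext
    show circleDiagonal 2 _ = circleDiagonal 2 _
    congr 1
    funext i; fin_cases i
    · exact hz0 ψ
    · exact hz2 ψ
  have hD : ∀ ψ : ℝ, ((circleDiagonal 1 ![(fun i => z₀ i * Circle.exp (![(1 : ℝ), 0, -1] i * ψ)) 1] : GL (Fin 1) ℂ) : Matrix (Fin 1) (Fin 1) ℂ) = ((circleDiagonal 1 ![z₀ 1] : GL (Fin 1) ℂ) : Matrix (Fin 1) (Fin 1) ℂ) := fun ψ => by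
    rw [hz1]
  -- THE IDENTITY on `0 < |ψ| < δ`: `2 sin ψ · F_Θ(z_ψ) = c₀ · [2 sin ψ · Orb_{G₂}(f♭)(ψ)]`
  have hId : ∀ ψ : ℝ, ψ ≠ 0 → |ψ| < δ →
      (2 * Real.sin ψ : ℂ) * ∫ g, Θ' (((g * ⟨circleDiagonal 3 (fun i => z₀ i * Circle.exp (![(1 : ℝ), 0, -1] i * ψ)), circleDiagonal_mem_archLocal_diagonal L 3 α w _⟩ * g⁻¹ : archLocal L 3 (Matrix.diagonal α) w) : GL (Fin 3) ℂ) : Matrix (Fin 3) (Fin 3) ℂ) ∂ν =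
      (c₀ : ℂ) * ((2 * Real.sin ψ) • ∫ h : unitaryGroupOfForm (starRingEnd ℂ) ((Matrix.diagonal ![α 0, α 2]).map w.1.embedding), (fun X : Matrix (Fin 2) (Fin 2) ℂ => ∫ g, (β g : ℂ) * Θ' (((g : GL (Fin 3) ℂ) : Matrix (Fin 3) (Fin 3) ℂ) * endoForm X ((circleDiagonal 1 ![z₀ 1] : GL (Fin 1) ℂ) : Matrix (Fin 1) (Fin 1) ℂ) * (((g : GL (Fin 3) ℂ)⁻¹ : GL (Fin 3) ℂ) : Matrix (Fin 3) (Fin 3) ℂ)) ∂ν)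
        (((h * (⟨circleDiagonal 2 ![z₀ 0 * Circle.exp ψ, z₀ 0 * Circle.exp (-ψ)], circleDiagonal_mem_archLocal_diagonal L 2 ![α 0, α 2] w _⟩ : unitaryGroupOfForm (starRingEnd ℂ) ((Matrix.diagonal ![α 0, α 2]).map w.1.embedding)) * h⁻¹ : unitaryGroupOfForm (starRingEnd ℂ) ((Matrix.diagonal ![α 0, α 2]).map w.1.embedding)) : GL (Fin 2) ℂ) : Matrix (Fin 2) (Fin 2) ℂ) ∂haar) := fun ψ hψ0 hψ => by
    rw [hB β hβ hβs _ (hreg ψ hψ0 hψ) Θ' hΘ'c hΘ'k (h1 ψ hψ.le)]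
    simp only [hT ψ, hD ψ, Complex.real_smul]
    push_cast
    ring
  -- hence the derivatives agree on the punctured neighbourhood
  have hderiv : ∀ᶠ ψ in 𝓝[≠] (0 : ℝ),
      deriv (fun ψ : ℝ => (2 * Real.sin ψ : ℂ) * ∫ g, Θ' (((g * ⟨circleDiagonal 3 (fun i => z₀ i * Circle.exp (![(1 : ℝ), 0, -1] i * ψ)), circleDiagonal_mem_archLocal_diagonal L 3 α w _⟩ * g⁻¹ : archLocal L 3 (Matrix.diagonal α) w) : GL (Fin 3) ℂ) : Matrix (Fin 3) (Fin 3) ℂ) ∂ν) ψ =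
      (c₀ : ℂ) * deriv (fun ψ : ℝ => (2 * Real.sin ψ) • ∫ h : unitaryGroupOfForm (starRingEnd ℂ) ((Matrix.diagonal ![α 0, α 2]).map w.1.embedding), (fun X : Matrix (Fin 2) (Fin 2) ℂ => ∫ g, (β g : ℂ) * Θ' (((g : GL (Fin 3) ℂ) : Matrix (Fin 3) (Fin 3) ℂ) * endoForm X ((circleDiagonal 1 ![z₀ 1] : GL (Fin 1) ℂ) : Matrix (Fin 1) (Fin 1) ℂ) * (((g : GL (Fin 3) ℂ)⁻¹ : GL (Fin 3) ℂ) : Matrix (Fin 3) (Fin 3) ℂ)) ∂ν)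
        (((h * (⟨circleDiagonal 2 ![z₀ 0 * Circle.exp ψ, z₀ 0 * Circle.exp (-ψ)], circleDiagonal_mem_archLocal_diagonal L 2 ![α 0, α 2] w _⟩ : unitaryGroupOfForm (starRingEnd ℂ) ((Matrix.diagonal ![α 0, α 2]).map w.1.embedding)) * h⁻¹ : unitaryGroupOfForm (starRingEnd ℂ) ((Matrix.diagonal ![α 0, α 2]).map w.1.embedding)) : GL (Fin 2) ℂ) : Matrix (Fin 2) (Fin 2) ℂ) ∂haar) ψ := by
    rw [eventually_nhdsWithin_iff, Metric.eventually_nhds_iff]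
    refine ⟨δ, hδ, fun ψ hψ hψ0 => ?_⟩
    have hψ' : |ψ| < δ := by simpa [Real.dist_eq] using hψ
    have hψ0' : ψ ≠ 0 := hψ0
    -- the two functions agree on the open set `ball 0 δ ∖ {0}` ∋ ψ
    have hEq : (fun ψ : ℝ => (2 * Real.sin ψ : ℂ) * ∫ g, Θ' (((g * ⟨circleDiagonal 3 (fun i => z₀ i * Circle.exp (![(1 : ℝ), 0, -1] i * ψ)), circleDiagonal_mem_archLocal_diagonal L 3 α w _⟩ * g⁻¹ : archLocal L 3 (Matrix.diagonal α) w) : GL (Fin 3) ℂ) : Matrix (Fin 3) (Fin 3) ℂ) ∂ν) =ᶠ[𝓝 ψ]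
        fun ψ : ℝ => (c₀ : ℂ) * ((2 * Real.sin ψ) • ∫ h : unitaryGroupOfForm (starRingEnd ℂ) ((Matrix.diagonal ![α 0, α 2]).map w.1.embedding), (fun X : Matrix (Fin 2) (Fin 2) ℂ => ∫ g, (β g : ℂ) * Θ' (((g : GL (Fin 3) ℂ) : Matrix (Fin 3) (Fin 3) ℂ) * endoForm X ((circleDiagonal 1 ![z₀ 1] : GL (Fin 1) ℂ) : Matrix (Fin 1) (Fin 1) ℂ) * (((g : GL (Fin 3) ℂ)⁻¹ : GL (Fin 3) ℂ) : Matrix (Fin 3) (Fin 3) ℂ)) ∂ν)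
          (((h * (⟨circleDiagonal 2 ![z₀ 0 * Circle.exp ψ, z₀ 0 * Circle.exp (-ψ)], circleDiagonal_mem_archLocal_diagonal L 2 ![α 0, α 2] w _⟩ : unitaryGroupOfForm (starRingEnd ℂ) ((Matrix.diagonal ![α 0, α 2]).map w.1.embedding)) * h⁻¹ : unitaryGroupOfForm (starRingEnd ℂ) ((Matrix.diagonal ![α 0, α 2]).map w.1.embedding)) : GL (Fin 2) ℂ) : Matrix (Fin 2) (Fin 2) ℂ) ∂haar) := by
      have hmem : Metric.ball (0 : ℝ) δ ∩ {(0 : ℝ)}ᶜ ∈ 𝓝 ψ :=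
        (Metric.isOpen_ball.inter isOpen_compl_singleton).mem_nhds ⟨hψ, hψ0'⟩
      filter_upwards [hmem] with ψ' hψ'
      exact hId ψ' hψ'.2 (by simpa [Real.dist_eq] using (Metric.mem_ball.mp hψ'.1))
    rw [hEq.deriv_eq]
    exact deriv_const_mul (c₀ : ℂ) (hdiff ψ ⟨by linarith [(abs_lt.mp (hδ1 ψ hψ')).1], (abs_lt.mp (hδ1 ψ hψ')).2⟩ hψ0')
  -- the singular side: `f♭(z₀(0)·1) = ∫ descConj (t_w z₀) Θ d(ν∕ν_H)` (★ (d3a))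
  have hsing : ∫ y, descConj (⟨circleDiagonal 3 z₀, circleDiagonal_mem_archLocal_diagonal L 3 α w z₀⟩ : archLocal L 3 (Matrix.diagonal α) w)
        (Subgroup.centralizer ({(⟨circleDiagonal 3 z₁, circleDiagonal_mem_archLocal_diagonal L 3 α w z₁⟩ : archLocal L 3 (Matrix.diagonal α) w)} : Set (archLocal L 3 (Matrix.diagonal α) w))) (forall_mem_centralizer_circleDiagonal_comm_of_wall L α w h02 h01 h02' h01')
        (fun k : archLocal L 3 (Matrix.diagonal α) w => Θ' ((k : GL (Fin 3) ℂ) : Matrix (Fin 3) (Fin 3) ℂ)) y ∂(quotientMeasure _ νH (isClosed_coe_centralizer_singleton _) ν) =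
      (fun X : Matrix (Fin 2) (Fin 2) ℂ => ∫ g, (β g : ℂ) * Θ' (((g : GL (Fin 3) ℂ) : Matrix (Fin 3) (Fin 3) ℂ) * endoForm X ((circleDiagonal 1 ![z₀ 1] : GL (Fin 1) ℂ) : Matrix (Fin 1) (Fin 1) ℂ) * (((g : GL (Fin 3) ℂ)⁻¹ : GL (Fin 3) ℂ) : Matrix (Fin 3) (Fin 3) ℂ)) ∂ν) (((z₀ 0 : Circle) : ℂ) • (1 : Matrix (Fin 2) (Fin 2) ℂ)) := by
    have h10 : ∀ g : archLocal L 3 (Matrix.diagonal α) w, Θ' (((g * (⟨circleDiagonal 3 z₀, circleDiagonal_mem_archLocal_diagonal L 3 α w z₀⟩ : archLocal L 3 (Matrix.diagonal α) w) * g⁻¹ : archLocal L 3 (Matrix.diagonal α) w) : GL (Fin 3) ℂ) : Matrix (Fin 3) (Fin 3) ℂ) ≠ 0 → ∫ h : Subgroup.centralizer ({(⟨circleDiagonal 3 z₁, circleDiagonal_mem_archLocal_diagonal L 3 α w z₁⟩ : archLocal L 3 (Matrix.diagonal α) w)} : Set (archLocal L 3 (Matrix.diagonal α) w)), β (g * h)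 ∂νH = 1 := by
      have h := h1 0 (by simpa using hδ.le)
      simpa [Circle.exp_zero] using h
    exact integral_descConj_wall_eq_integral_mul_averaged L α w _ h02' νH ν β hβ hβs Θ' hΘ'c h10
  -- conclude
  have hval : ((c₀ * C : ℝ) : ℂ) * ∫ y, descConj (⟨circleDiagonal 3 z₀, circleDiagonal_mem_archLocal_diagonal L 3 α w z₀⟩ : archLocal L 3 (Matrix.diagonal α) w)
        (Subgroup.centralizer ({(⟨circleDiagonal 3 z₁, circleDiagonal_mem_archLocal_diagonal L 3 α w z₁⟩ : archLocal L 3 (Matrix.diagonal α) w)} : Set (archLocal L 3 (Matrix.diagonal α) w))) (forall_mem_centralizer_circleDiagonal_comm_of_wall L α w h02 h01 h02' h01')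
        (fun k : archLocal L 3 (Matrix.diagonal α) w => Θ' ((k : GL (Fin 3) ℂ) : Matrix (Fin 3) (Fin 3) ℂ)) y ∂(quotientMeasure _ νH (isClosed_coe_centralizer_singleton _) ν) =
      (c₀ : ℂ) * (C • (fun X : Matrix (Fin 2) (Fin 2) ℂ => ∫ g, (β g : ℂ) * Θ' (((g : GL (Fin 3) ℂ) : Matrix (Fin 3) (Fin 3) ℂ) * endoForm X ((circleDiagonal 1 ![z₀ 1] : GL (Fin 1) ℂ) : Matrix (Fin 1) (Fin 1) ℂ) * (((g : GL (Fin 3) ℂ)⁻¹ : GL (Fin 3) ℂ) : Matrix (Fin 3) (Fin 3) ℂ)) ∂ν) (((z₀ 0 : Circle) : ℂ) • (1 : Matrix (Fin 2) (Fin 2) ℂ))) := by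
    rw [hsing, Complex.real_smul, Complex.ofReal_mul, mul_assoc]
  rw [hval]
  exact (hlim.const_mul (c₀ : ℂ)).congr' (hderiv.mono fun ψ h => h.symm)

end Literature.NumberTheory.Rogawski1990

end
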